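import Summits.Ventures.PercRepro.ProfilePointedCircuitClassesTwelveCocircuitB

/-!
# PercRepro — THE COCIRCUIT REGIME, PART C: THE LOCAL LYM ASSEMBLED AND THE TWO INJECTIONS OF THE DOUBLY CAPTURED
DEMANDS (p5, gen 48; `proofs/P5-GM1.md` §71)

With parts A–B: (1) `card_demand_le_card_unit` — the `Q`-tight 3-sets of `G₀` are at most the `Q`-tight 4-sets
(the local LYM of `Y ⊂ Y'`, `card_le_card_of_localLym`); (2) the doubly captured demands `W = Y + e + a`
(`a', p ∈ cl W`) inject into those 3-sets by `W ↦ W − e − a`, and the 4-sets inject into the capturing units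
`S = Y' + a + p` avoiding `a'` by `Y' ↦ Y' + a + p`.  Part D adds the singly captured demands and assembles the
capture inequality (C) and the twelve-point statement at `e`.
-/

open scoped Matroid

namespace PercRepro.Cogirth

open Finset ThmH Skew Shadow Profile

variable {α : Type} [DecidableEq α] {N : Matroid α} [N.Finite]

section TwelveCocircuitC

/-- **THE LOCAL LYM OF THE CONTAINMENT RELATION**: the `Q`-tight bi-independent 3-sets of `G₀` (with basis complement)
are at most the `Q`-tight bi-independent 4-sets — `card_le_card_of_localLym` on `Y ⊂ Y'`. -/
theorem card_demand_le_card_unit (hn : (gr N).card = 12) {a a' e p : α} (h : SeriesPair N a a') (he : e ∈ gr N)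
    (hp : p ∈ gr N) (hea : e ≠ a) (hea' : e ≠ a') (hpa : p ≠ a) (hpa' : p ≠ a') (hep : e ≠ p)
    (hQ : rk N {a, a', e} = 3)
    (hH : ∀ X ⊆ (((gr N).erase a').erase e).erase p,
      rk N (insert a' X) = rk N X + 1 ∧ rk N (insert e X) = rk N X + 1 ∧ rk N (insert p X) = rk N X + 1) :
    ((((((gr N).erase a').erase e).erase p).erase a).powerset.filter
      (fun Y => Y.card = 3 ∧ rk N Y = 3 ∧
        rk N (insert a' (insert p (((((gr N).erase a').erase e).erase p).erase a \ Y))) = 7 ∧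
        rk N (Y ∪ insert a (insert a' (insert e {p}))) = 5)).card ≤
    ((((((gr N).erase a').erase e).erase p).erase a).powerset.filter
      (fun Y' => Y'.card = 4 ∧ rk N Y' = 4 ∧ rk N (((((gr N).erase a').erase e).erase p).erase a \ Y') = 4 ∧
        rk N (Y' ∪ insert a (insert a' (insert e {p}))) = 6)).card := by
  apply card_le_card_of_localLym _ _ (fun Y Y' => Y ⊆ Y')
  · intro Y hY
    have h2 := two_le_card_filter_rk_insert_eq_four hn h he hp hea hea' hpa hpa' hep hY
    obtain ⟨z, hz⟩ := card_pos.1 (by omega : 0 < ((((((gr N).erase a').erase e).erase p).erase a \ Y).filter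
      (fun z => rk N (insert z Y) = 4)).card)
    rw [mem_filter] at hz
    apply card_pos.2 ⟨insert z Y, ?_⟩
    rw [mem_filter]
    exact ⟨insert_mem_unit_of_mem_demand hn h he hp hea hea' hpa hpa' hep hH hY hz.1 hz.2, subset_insert _ _⟩
  · intro Y hY Y' hY' hYY'
    have hY'c : Y'.card = 4 := (mem_filter.1 hY').2.1
    calc (((((((gr N).erase a').erase e).erase p).erase a).powerset.filter
          (fun Y => Y.card = 3 ∧ rk N Y = 3 ∧
            rk N (insert a' (insert p (((((gr N).erase a').erase e).erase p).erase a \ Y))) = 7 ∧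
            rk N (Y ∪ insert a (insert a' (insert e {p}))) = 5)).filter (fun Z => Z ⊆ Y')).card
        ≤ (Y'.filter (fun z => Y'.erase z ∈ (((((gr N).erase a').erase e).erase p).erase a).powerset.filter
          (fun Y => Y.card = 3 ∧ rk N Y = 3 ∧
            rk N (insert a' (insert p (((((gr N).erase a').erase e).erase p).erase a \ Y))) = 7 ∧
            rk N (Y ∪ insert a (insert a' (insert e {p}))) = 5))).card := by
          apply card_le_card_of_surjOn (fun z => Y'.erase z)
          intro Z hZ
          rw [mem_coe, mem_filter] at hZ
          obtain ⟨hZd, hZsub⟩ := hZ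
          have hZc : Z.card = 3 := (mem_filter.1 hZd).2.1
          have hsd : (Y' \ Z).card = 1 := by rw [card_sdiff_of_subset hZsub, hY'c, hZc]
          obtain ⟨z, hz⟩ := card_eq_one.1 hsd
          have hzY' : z ∈ Y' := (mem_sdiff.1 (hz ▸ mem_singleton_self z : z ∈ Y' \ Z)).1
          have hzZ : z ∉ Z := (mem_sdiff.1 (hz ▸ mem_singleton_self z : z ∈ Y' \ Z)).2
          have hY'eq : Y' = insert z Z := by
            rw [← union_sdiff_of_subset hZsub, hz, union_comm, ← insert_eq]
          have herase : Y'.erase z = Z := by rw [hY'eq, erase_insert hzZ]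
          refine ⟨z, ?_, herase⟩
          rw [mem_coe, mem_filter, herase]
          exact ⟨hzY', hZd⟩
      _ ≤ ((((((gr N).erase a').erase e).erase p).erase a \ Y).filter (fun z => rk N (insert z Y) = 4)).card :=
          card_filter_erase_mem_demand_le_card_filter_rk_insert hn h he hp hea hea' hpa hpa' hep hQ hY hY' hYY'
      _ ≤ (((((((gr N).erase a').erase e).erase p).erase a).powerset.filter
          (fun Y' => Y'.card = 4 ∧ rk N Y' = 4 ∧
            rk N (((((gr N).erase a').erase e).erase p).erase a \ Y') = 4 ∧
            rk N (Y' ∪ insert a (insert a' (insert e {p}))) = 6)).filter (fun Z => Y ⊆ Z)).card := by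
          apply card_le_card_of_injOn (fun z => insert z Y)
          · intro z hz
            rw [mem_coe, mem_filter] at hz
            rw [mem_coe, mem_filter]
            exact ⟨insert_mem_unit_of_mem_demand hn h he hp hea hea' hpa hpa' hep hH hY hz.1 hz.2,
              subset_insert _ _⟩
          · intro z₁ hz₁ z₂ hz₂ heq
            rw [mem_coe, mem_filter, mem_sdiff] at hz₁ hz₂
            have heq' : insert z₁ Y = insert z₂ Y := heq
            have h1 : z₁ ∈ insert z₂ Y := by rw [← heq']; exact mem_insert_self z₁ Y
            rw [mem_insert] at h1
            exact h1.resolve_right hz₁.1.2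

/-- **A DOUBLY CAPTURED DEMAND IS A `Q`-TIGHT 3-SET**: `W ↦ W − e − a` injects the demands `W ∈ BI_5`, `e, a ∈ W`,
`a', p ∈ cl W` into the `Q`-tight bi-independent 3-sets of `G₀`. -/
theorem card_filter_doubly_captured_le_card_demand (hn : (gr N).card = 12) (hR : rk N (gr N) = 7) {a a' e p : α}
    (h : SeriesPair N a a') (he : e ∈ gr N) (hp : p ∈ gr N) (hea : e ≠ a) (hea' : e ≠ a') (hpa : p ≠ a)
    (hpa' : p ≠ a') (hep : e ≠ p) (hcoc : rk N ((((gr N).erase a').erase e).erase p) = 6) :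
    ((biIndepSets N 5).filter (fun W => ((e ∈ W ∧ a ∈ W) ∧ rk N (insert a' W) = 5) ∧ rk N (insert p W) = 5)).card ≤
    ((((((gr N).erase a').erase e).erase p).erase a).powerset.filter
      (fun Y => Y.card = 3 ∧ rk N Y = 3 ∧
        rk N (insert a' (insert p (((((gr N).erase a').erase e).erase p).erase a \ Y))) = 7 ∧
        rk N (Y ∪ insert a (insert a' (insert e {p}))) = 5)).card := by
  have ha : a ∈ gr N := h.1
  have ha' : a' ∈ gr N := h.2.1
  apply card_le_card_of_injOn (fun W => (W.erase e).erase a)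
  · intro W hW
    rw [mem_coe, mem_filter] at hW
    obtain ⟨hWb, ⟨⟨heW, haW⟩, hWa'⟩, hWp⟩ := hW
    obtain ⟨hWg, hWc, hWr, hWcompl⟩ := mem_biIndepSets.1 hWb
    obtain ⟨ha'W, hpW⟩ := not_mem_of_mem_biIndepSets_five_cocircuit hn hR h hea hpa hcoc hWb heW haW
    have hWr5 : rk N W = 5 := by rw [hWr, hWc]
    have haW' : a ∈ W.erase e := mem_erase.2 ⟨hea.symm, haW⟩
    have hYW : (W.erase e).erase a ⊆ W := (erase_subset _ _).trans (erase_subset _ _)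
    have hWeq : W = insert e (insert a ((W.erase e).erase a)) := by
      rw [insert_erase haW', insert_erase heW]
    rw [mem_coe, mem_filter, mem_powerset]
    refine ⟨?_, ?_, ?_, ?_, ?_⟩
    · intro x hx
      simp only [mem_erase] at hx ⊢
      exact ⟨hx.1, fun h' => hpW (h' ▸ hx.2.2), hx.2.1, fun h' => ha'W (h' ▸ hx.2.2), hWg hx.2.2⟩
    · show ((W.erase e).erase a).card = 3
      rw [card_erase_of_mem haW', card_erase_of_mem heW, hWc]
    · show rk N ((W.erase e).erase a) = 3
      rw [rk_eq_card_of_subset_of_rk_eq_card hYW hWr, card_erase_of_mem haW', card_erase_of_mem heW, hWc]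
    · -- `(G₀ ∖ Y) + p + a' = E ∖ W`
      have heq : insert a' (insert p (((((gr N).erase a').erase e).erase p).erase a \ (W.erase e).erase a)) =
          gr N \ W := by
        ext x
        simp only [mem_insert, mem_sdiff, mem_erase]
        constructor
        · rintro (rfl | rfl | ⟨⟨hxa, hxp, hxe, hxa', hxg⟩, hx⟩)
          · exact ⟨ha', ha'W⟩
          · exact ⟨hp, hpW⟩
          · exact ⟨hxg, fun hxW => hx ⟨hxa, hxe, hxW⟩⟩
        · rintro ⟨hxg, hxW⟩
          by_cases hxa' : x = a'
          · exact Or.inl hxa'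
          by_cases hxp : x = p
          · exact Or.inr (Or.inl hxp)
          refine Or.inr (Or.inr ⟨⟨fun hxa => hxW (hxa ▸ haW), hxp, fun hxe => hxW (hxe ▸ heW), hxa', hxg⟩,
            fun hx => hxW hx.2.2⟩)
      rw [heq, hWcompl, card_sdiff_of_subset hWg, hn, hWc]
    · -- `Y ∪ Q = W ∪ {a', p}` has rank `ρ(W) = 5`
      have hcl : ({a', p} : Finset α) ⊆ clF N W := by
        intro x hx
        rw [mem_insert, mem_singleton] at hx
        rcases hx with rfl | rfl
        · rw [mem_clF_iff_rk_insert_eq ha' hWg, hWa', hWr5]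
        · rw [mem_clF_iff_rk_insert_eq hp hWg, hWp, hWr5]
      have heq : (W.erase e).erase a ∪ insert a (insert a' (insert e {p})) = W ∪ {a', p} := by
        ext x
        simp only [mem_union, mem_erase, mem_insert, mem_singleton]
        constructor
        · rintro (⟨_, _, hxW⟩ | rfl | rfl | rfl | rfl)
          · exact Or.inl hxW
          · exact Or.inl haW
          · exact Or.inr (Or.inl rfl)
          · exact Or.inl heW
          · exact Or.inr (Or.inr rfl)
        · rintro (hxW | rfl | rfl)
          · by_cases hxa : x = a
            · exact Or.inr (Or.inl hxa)
            by_cases hxe : x = e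
            · exact Or.inr (Or.inr (Or.inr (Or.inl hxe)))
            exact Or.inl ⟨hxa, hxe, hxW⟩
          · exact Or.inr (Or.inr (Or.inl rfl))
          · exact Or.inr (Or.inr (Or.inr (Or.inr rfl)))
      rw [heq, rk_union_eq_of_subset_clF hWg hcl, hWr5]
  · intro W₁ hW₁ W₂ hW₂ heq
    rw [mem_coe, mem_filter] at hW₁ hW₂
    have h1 : a ∈ W₁.erase e := mem_erase.2 ⟨hea.symm, hW₁.2.1.1.2⟩
    have h2 : a ∈ W₂.erase e := mem_erase.2 ⟨hea.symm, hW₂.2.1.1.2⟩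
    have heq' : (W₁.erase e).erase a = (W₂.erase e).erase a := heq
    rw [← insert_erase hW₁.2.1.1.1, ← insert_erase hW₂.2.1.1.1, ← insert_erase h1, ← insert_erase h2, heq']

/-- **A `Q`-TIGHT 4-SET IS A CAPTURING UNIT**: `Y' ↦ Y' + a + p` injects the `Q`-tight bi-independent 4-sets of `G₀`
into the units `S ∈ BI_6`, `e ∉ S`, `a ∈ S`, `a' ∉ S`, `ρ(S + a') = 6`. -/
theorem card_unit_le_card_filter_capturing (hn : (gr N).card = 12) {a a' e p : α} (h : SeriesPair N a a')
    (he : e ∈ gr N) (hp : p ∈ gr N) (hea : e ≠ a) (hea' : e ≠ a') (hpa : p ≠ a) (hpa' : p ≠ a') (hep : e ≠ p)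
    (hH : ∀ X ⊆ (((gr N).erase a').erase e).erase p,
      rk N (insert a' X) = rk N X + 1 ∧ rk N (insert e X) = rk N X + 1 ∧ rk N (insert p X) = rk N X + 1) :
    ((((((gr N).erase a').erase e).erase p).erase a).powerset.filter
      (fun Y' => Y'.card = 4 ∧ rk N Y' = 4 ∧ rk N (((((gr N).erase a').erase e).erase p).erase a \ Y') = 4 ∧
        rk N (Y' ∪ insert a (insert a' (insert e {p}))) = 6)).card ≤
    ((biIndepSets N 6).filter (fun S => ((e ∉ S ∧ a ∈ S) ∧ a' ∉ S) ∧ rk N (insert a' S) = 6)).card := by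
  have ha : a ∈ gr N := h.1
  have ha' : a' ∈ gr N := h.2.1
  have hne : a ≠ a' := h.2.2.1
  have hG₀c := card_G₀_eq_eight hn ha ha' he hp hne hea hea' hpa hpa' hep
  have ⟨haG, ha'G, heG, hpG⟩ := notMem_of_subset_G₀ (N := N) (a := a) (a' := a') (e := e) (p := p) (subset_refl _)
  apply card_le_card_of_injOn (fun Y' => insert a (insert p Y'))
  · intro Y' hY'
    rw [mem_coe, mem_filter, mem_powerset] at hY'
    obtain ⟨hY'G, hY'c, hY'r, hY'compl, hY'Q⟩ := hY'
    have hY'g : Y' ⊆ gr N := hY'G.trans G₀_subset_gr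
    have hpY' : p ∉ Y' := fun h' => hpG (hY'G h')
    have haY' : a ∉ insert p Y' := by
      rw [mem_insert, not_or]
      exact ⟨hpa.symm, fun h' => haG (hY'G h')⟩
    have hpY'H : insert p Y' ⊆ ((gr N).erase a).erase a' := by
      intro x hx
      rw [mem_insert] at hx
      rcases hx with rfl | hx
      · exact mem_erase.2 ⟨hpa', mem_erase.2 ⟨hpa, hp⟩⟩
      · exact G₀_subset_G (hY'G hx)
    have hSr : rk N (insert a (insert p Y')) = 6 := by
      rw [rk_insert_left_eq_add_one_of_seriesPair h hpY'H, (hH Y' (hY'G.trans G₀_subset_H)).2.2, hY'r]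
    have hSc : (insert a (insert p Y')).card = 6 := by
      rw [card_insert_of_notMem haY', card_insert_of_notMem hpY', hY'c]
    -- the complement `E ∖ S = (G₀ ∖ Y') + e + a'` is independent
    have hcompl : gr N \ insert a (insert p Y') = insert a' (insert e (((((gr N).erase a').erase e).erase p).erase a \ Y')) := by
      ext x
      simp only [mem_sdiff, mem_insert, mem_erase, not_or]
      constructor
      · rintro ⟨hxg, hxa, hxp, hxY'⟩
        by_cases hxa' : x = a'
        · exact Or.inl hxa'
        by_cases hxe : x = e
        · exact Or.inr (Or.inl hxe)
        exact Or.inr (Or.inr ⟨⟨hxa, hxp, hxe, hxa', hxg⟩, hxY'⟩)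
      · rintro (rfl | rfl | ⟨⟨hxa, hxp, hxe, hxa', hxg⟩, hxY'⟩)
        · exact ⟨ha', hne.symm, hpa'.symm, fun h' => ha'G (hY'G h')⟩
        · exact ⟨he, hea, hep, fun h' => heG (hY'G h')⟩
        · exact ⟨hxg, hxa, hxp, hxY'⟩
    have hcomplG₀ : ((((gr N).erase a').erase e).erase p).erase a \ Y' ⊆ ((((gr N).erase a').erase e).erase p).erase a :=
      sdiff_subset
    have hcompl_c : (((((gr N).erase a').erase e).erase p).erase a \ Y').card = 4 := by
      rw [card_sdiff_of_subset hY'G, hG₀c, hY'c]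
    have heC : e ∉ ((((gr N).erase a').erase e).erase p).erase a \ Y' := fun h' => heG (mem_sdiff.1 h').1
    have ha'C : a' ∉ insert e (((((gr N).erase a').erase e).erase p).erase a \ Y') := by
      rw [mem_insert, not_or]
      exact ⟨hea'.symm, fun h' => ha'G (mem_sdiff.1 h').1⟩
    have hcompl_r : rk N (insert a' (insert e (((((gr N).erase a').erase e).erase p).erase a \ Y'))) = 6 := by
      have h1 := (hH _ (hcomplG₀.trans G₀_subset_H)).2.1
      have h2 : insert e (((((gr N).erase a').erase e).erase p).erase a \ Y') ⊆ ((gr N).erase a).erase a' := by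
        intro x hx
        rw [mem_insert] at hx
        rcases hx with rfl | hx
        · exact mem_erase.2 ⟨hea', mem_erase.2 ⟨hea, he⟩⟩
        · exact G₀_subset_G (hcomplG₀ hx)
      rw [rk_insert_right_eq_add_one_of_seriesPair h h2, h1, hY'compl]
    rw [mem_coe, mem_filter, mem_biIndepSets]
    refine ⟨⟨insert_subset ha (insert_subset hp hY'g), hSc, by rw [hSr, hSc], ?_⟩, ⟨⟨?_, mem_insert_self _ _⟩, ?_⟩, ?_⟩
    · rw [hcompl, hcompl_r, card_insert_of_notMem ha'C, card_insert_of_notMem heC, hcompl_c]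
    · rw [mem_insert, mem_insert, not_or, not_or]
      exact ⟨hea, hep, fun h' => heG (hY'G h')⟩
    · rw [mem_insert, mem_insert, not_or, not_or]
      exact ⟨hne.symm, hpa'.symm, fun h' => ha'G (hY'G h')⟩
    · show rk N (insert a' (insert a (insert p Y'))) = 6
      have h1 := rk_mono' (M := N) (subset_insert a' (insert a (insert p Y')))
      have hsub : insert a' (insert a (insert p Y')) ⊆ Y' ∪ insert a (insert a' (insert e {p})) := by
        intro x hx
        simp only [mem_insert, mem_union, mem_singleton] at hx ⊢
        tauto
      have h2 := rk_mono' (M := N) hsub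
      omega
  · intro Y₁ hY₁ Y₂ hY₂ heq
    rw [mem_coe, mem_filter, mem_powerset] at hY₁ hY₂
    have hp₁ : p ∉ Y₁ := fun h' => hpG (hY₁.1 h')
    have hp₂ : p ∉ Y₂ := fun h' => hpG (hY₂.1 h')
    have ha₁ : a ∉ insert p Y₁ := by rw [mem_insert, not_or]; exact ⟨hpa.symm, fun h' => haG (hY₁.1 h')⟩
    have ha₂ : a ∉ insert p Y₂ := by rw [mem_insert, not_or]; exact ⟨hpa.symm, fun h' => haG (hY₂.1 h')⟩
    have heq' : insert a (insert p Y₁) = insert a (insert p Y₂) := heq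
    rw [← erase_insert hp₁, ← erase_insert hp₂, ← erase_insert ha₁, ← erase_insert ha₂, heq']

end TwelveCocircuitC

end PercRepro.Cogirth
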